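import Summits.QuantumAdvantage.QuantumAdvantage.Theorems.SosSandwichQueryHomogeneousRung
import HarnessLib

/-!
# `Q_T`: the SECOND-HIGHEST Walsh level of a quantum acceptance probability — one-step algebra

Support theorem for route `SosSandwich`, crux `PseudoBoundedAA` (stmt-QuantumAdvantage-15237); continuation of the
package `SosSandwichQueryTopLevel{Step,Weight}` / `SosSandwichQueryHomogeneousRung` (the TOP level: Escudero
Gutiérrez Cor 1.7).  Goal of this part and the next: the same DEGREE-FREE influence bound for the Walsh level
`2T − 1` of a `T`-query acceptance probability (`T ≥ 2`): `∃ k, (Σ_{|U| = 2T−1} p̂(U)²)² ≤ 4·Inf_k[p]`.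

Mechanism.  A Walsh coefficient of the running state at ONE BELOW the top level is reached by words with exactly one
"stay" move (the `|+⟩⟨+|` part `P_+ = blockPlus` of the oracle, which consumes no index) and otherwise only "add"
moves (`Δ_k = blockDiff k`); no index is ever repeated, so Escudero Gutiérrez's obstruction (Remark 4.3: repeated
indices) does not arise at this level for GENUINE algorithms.  This file: the one-step algebra —
`blockPlus`, its orthogonality to the `Δ_k` and the completeness relation `Σ_k ‖Δ_k x‖² + ‖P_+ x‖² = ‖x‖²`, the
second-level oracle step `v'_S = U (P_+ v_S + Σ_{k∈S} Δ_k v_{S∖k})` (`|S| = t`, level `≤ t`), and the resulting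
recursion for the functional `Γ = gam` one below the top: `Γ'(R) = U (P_+ Γ(R) + Σ_{k∉R} Δ_k Γ(R ∪ k))`.

Sources: EscuderoGutierrez2023 (arXiv:2304.06713) §4.2 and Remark 4.3; BealsEtAl2001 Lemma 4.1.
-/

noncomputable section

set_option linter.dupNamespace false

namespace Summit.QuantumAdvantage.QuantumAdvantage.Theorems.SosSandwich.QueryTopLevel

open Matrix Finset Literature.Computability.Cryptography Literature.Computability.QuantumComplexity
open Literature.Computability.Complexity.LowDegree Literature.Probability.RandomGraphs.LowDegree
open Summit.QuantumAdvantage.QuantumAdvantage.Theorems.SosSandwich.QueryFourier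
open scoped symmDiff

variable {N : ℕ} {W : Type*}

/-! ### The stay operator `P_+` -/

/-- `P_+ φ (k, b, w) = (φ(k,b,w) + φ(k,¬b,w))/2`: the component of every block along the target-qubit state `|+⟩`
— the input-independent ("stay") part of the XOR oracle. [cite: BealsEtAl2001, Lemma 4.1 (proof)] -/
def blockPlus (φ : Fin N × Bool × W → ℂ) : Fin N × Bool × W → ℂ :=
  fun s => (φ (s.1, s.2.1, s.2.2) + φ (s.1, !s.2.1, s.2.2)) / 2

/-- Unfolding lemma for `blockPlus`. [folklore] -/
@[simp]
theorem blockPlus_apply (φ : Fin N × Bool × W → ℂ) (k : Fin N) (b : Bool) (w : W) :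
    blockPlus φ (k, b, w) = (φ (k, b, w) + φ (k, !b, w)) / 2 := rfl

/-- `P_+` is linear: it commutes with finite linear combinations. [folklore] -/
theorem blockPlus_sum_smul {ι : Type*} (s : Finset ι) (a : ι → ℂ) (φ : ι → Fin N × Bool × W → ℂ) :
    blockPlus (∑ i ∈ s, a i • φ i) = ∑ i ∈ s, a i • blockPlus (φ i) := by
  funext x
  obtain ⟨k, b, w⟩ := x
  simp only [blockPlus_apply, Finset.sum_apply, Pi.smul_apply, smul_eq_mul]
  rw [← Finset.sum_add_distrib, Finset.sum_div]
  refine Finset.sum_congr rfl fun i _ => ?_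
  ring

/-- `P_+ (a • φ) = a • P_+ φ`. [folklore] -/
theorem blockPlus_smul (a : ℂ) (φ : Fin N × Bool × W → ℂ) : blockPlus (a • φ) = a • blockPlus φ := by
  funext x
  obtain ⟨k, b, w⟩ := x
  simp only [blockPlus_apply, Pi.smul_apply, smul_eq_mul]
  ring

/-- `P_+ (φ - ψ) = P_+ φ - P_+ ψ`. [folklore] -/
theorem blockPlus_sub (φ ψ : Fin N × Bool × W → ℂ) : blockPlus (φ - ψ) = blockPlus φ - blockPlus ψ := by
  funext x
  obtain ⟨k, b, w⟩ := x
  simp only [blockPlus_apply, Pi.sub_apply]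
  ring

variable [Fintype W]

/-- **Orthogonality of `P_+` and the `Δ_k`**: `‖P_+ a + Σ_{k ∈ K} Δ_k b_k‖² = ‖P_+ a‖² + Σ_{k ∈ K} ‖Δ_k b_k‖²`
(`P_+ a` is even and `Δ_k b_k` odd under the target-bit flip of each block). [folklore] -/
theorem norm_sq_blockPlus_add_sum_blockDiff (a : Fin N × Bool × W → ℂ) (K : Finset (Fin N))
    (b : Fin N → Fin N × Bool × W → ℂ) :
    ∑ s, ‖(blockPlus a + ∑ k ∈ K, blockDiff k (b k)) s‖ ^ 2 =
      ∑ s, ‖blockPlus a s‖ ^ 2 + ∑ k ∈ K, ∑ s, ‖blockDiff k (b k) s‖ ^ 2 := by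
  rw [← norm_sq_sum_blockDiff K b, ← Finset.sum_add_distrib]
  -- pair up `(k, true, w)` and `(k, false, w)`
  rw [Fintype.sum_prod_type, Fintype.sum_prod_type]
  refine Finset.sum_congr rfl fun k _ => ?_
  rw [Fintype.sum_prod_type, Fintype.sum_prod_type]
  simp only [Fintype.sum_bool]
  rw [← Finset.sum_add_distrib, ← Finset.sum_add_distrib]
  refine Finset.sum_congr rfl fun w _ => ?_
  simp only [Pi.add_apply, blockPlus_apply, sum_blockDiff_apply, Bool.not_true, Bool.not_false]
  -- even part `e`, odd part `± o`
  set e : ℂ := (a (k, true, w) + a (k, false, w)) / 2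
  have he : (a (k, false, w) + a (k, true, w)) / 2 = e := by simp only [e]; ring
  rw [he]
  split_ifs with hk
  · set o : ℂ := (b k (k, true, w) - b k (k, false, w)) / 2
    have ho : (b k (k, false, w) - b k (k, true, w)) / 2 = -o := by simp only [o]; ring
    rw [ho]
    -- `|e+o|² + |e−o|² = 2|e|² + 2|o|²`
    have h1 : ‖e + o‖ ^ 2 + ‖e + -o‖ ^ 2 = 2 * ‖e‖ ^ 2 + 2 * ‖o‖ ^ 2 := by
      rw [← sub_eq_add_neg]
      simp only [Complex.sq_norm, Complex.normSq_apply, Complex.add_re, Complex.add_im, Complex.sub_re,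
        Complex.sub_im]
      ring
    rw [h1, norm_neg]
    ring
  · simp

/-- **Completeness of the block decomposition**: `Σ_k ‖Δ_k x‖² + ‖P_+ x‖² = ‖x‖²`. [folklore] -/
theorem sum_norm_sq_blockDiff_add_blockPlus (x : Fin N × Bool × W → ℂ) :
    ∑ k, ∑ s, ‖blockDiff k x s‖ ^ 2 + ∑ s, ‖blockPlus x s‖ ^ 2 = ∑ s, ‖x s‖ ^ 2 := by
  have h := norm_sq_blockPlus_add_sum_blockDiff x Finset.univ (fun _ => x)
  -- the left side of `h` is `‖x‖²`: `P_+ x + Σ_k Δ_k x = x`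
  have hsum : blockPlus x + ∑ k, blockDiff k ((fun _ : Fin N => x) k) = x := by
    funext s
    obtain ⟨k, b, w⟩ := s
    rw [Pi.add_apply, sum_blockDiff_apply, blockPlus_apply, if_pos (Finset.mem_univ k)]
    ring
  rw [hsum] at h
  rw [h]
  ring

/-! ### One oracle step ONE BELOW the new top level -/

omit [Fintype W] in
/-- **Second-level step, operator form**: if `Ψ` has Walsh level `≤ t` and `|S| = t`, then
`(OΨ)^(S) = P_+ Ψ^(S) + Σ_{k ∈ S} Δ_k Ψ^(S∖k)` (the "remove" terms `Ψ^(S ∪ k)` vanish by the level bound).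
[cite: BealsEtAl2001, Lemma 4.1 (proof)] -/
theorem vfc_oracle_second [Fintype W] [DecidableEq W] {t : ℕ}
    {ψ : (Fin N → Bool) → Fin N × Bool × W → ℂ}
    (h : ∀ S : Finset (Fin N), t < S.card → vfc ψ S = 0) {S : Finset (Fin N)} (hS : S.card = t) :
    vfc (fun x => queryOracle x *ᵥ ψ x) S = blockPlus (vfc ψ S) + ∑ k ∈ S, blockDiff k (vfc ψ (S.erase k)) := by
  funext s
  obtain ⟨k', b, w⟩ := s
  rw [vfc_oracle, Pi.add_apply, blockPlus_apply, sum_blockDiff_apply]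
  by_cases hk : k' ∈ S
  · have : S ∆ {k'} = S.erase k' := by
      ext j; by_cases hj : j = k' <;> simp [Finset.mem_symmDiff, hj, hk]
    rw [if_pos hk, this]
  · have : S ∆ {k'} = insert k' S := by
      ext j; by_cases hj : j = k' <;> simp [Finset.mem_symmDiff, hj, hk]
    rw [if_neg hk, this, h (insert k' S) (by rw [Finset.card_insert_of_notMem hk]; omega)]
    simp

/-- **The recursion one below the top**: for `Ψ` of level `≤ t` and `|R| + t = T₂`,
`Γ[M(OΨ)](R) = M (P_+ Γ[Ψ](R) + Σ_{k ∉ R} Δ_k Γ[Ψ](R ∪ {k}))`. [cite: EscuderoGutierrez2023, §4.2] -/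
theorem gam_step_second [DecidableEq W] (c : Finset (Fin N) → ℂ) {T₂ t : ℕ}
    {ψ : (Fin N → Bool) → Fin N × Bool × W → ℂ}
    (h : ∀ S : Finset (Fin N), t < S.card → vfc ψ S = 0)
    (M : Matrix (Fin N × Bool × W) (Fin N × Bool × W) ℂ) {R : Finset (Fin N)} (hR : R.card + t = T₂) :
    gam c T₂ (fun x => M *ᵥ (queryOracle x *ᵥ ψ x)) R =
      M *ᵥ (blockPlus (gam c T₂ ψ R) + ∑ k ∈ Rᶜ, blockDiff k (gam c T₂ ψ (insert k R))) := by
  rw [gam_mulVec]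
  congr 1
  unfold gam
  have e1 : ∀ U ∈ Finset.univ.filter (fun U : Finset (Fin N) => U.card = T₂ ∧ R ⊆ U),
      c U • vfc (fun x => queryOracle x *ᵥ ψ x) (U \ R) =
        c U • blockPlus (vfc ψ (U \ R)) + ∑ k ∈ U \ R, c U • blockDiff k (vfc ψ (U \ insert k R)) := by
    intro U hU
    rw [Finset.mem_filter] at hU
    have hcard : (U \ R).card = t := by
      rw [Finset.card_sdiff_of_subset hU.2.2]; omega
    rw [vfc_oracle_second h hcard, smul_add, Finset.smul_sum]
    congr 1
    refine Finset.sum_congr rfl fun k _ => ?_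
    rw [Finset.sdiff_insert]
  rw [Finset.sum_congr rfl e1, Finset.sum_add_distrib, sum_supset_sum_sdiff, blockPlus_sum_smul]
  congr 1
  refine Finset.sum_congr rfl fun k _ => ?_
  rw [blockDiff_sum_smul]

omit [Fintype W] in
/-- The empty coefficient after ONE step from a constant state `u`: `(M(Ou))^(∅) = M P_+ u`. [cite: BealsEtAl2001, Lemma 4.1] -/
theorem vfc_step_const_empty [Fintype W] [DecidableEq W] (M : Matrix (Fin N × Bool × W) (Fin N × Bool × W) ℂ)
    (u : Fin N × Bool × W → ℂ) :
    vfc (fun x => M *ᵥ (queryOracle x *ᵥ (fun _ : Fin N → Bool => u) x)) ∅ = M *ᵥ blockPlus u := by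
  rw [vfc_mulVec, vfc_oracle_second (t := 0) (level_const u) Finset.card_empty, Finset.sum_empty, add_zero,
    vfc_const_empty]

/-- **Base case with a sub-normalised start**: as `base_bound`, for `‖u‖² ≤ 1`. [cite: EscuderoGutierrez2023, proof of Thm 1.6] -/
theorem base_bound_le (c : Finset (Fin N) → ℂ) {T₂ : ℕ}
    (hc : ∀ k : Fin N, ∑ U ∈ Finset.univ.filter (fun U : Finset (Fin N) => U.card = T₂ ∧ k ∈ U), ‖c U‖ ^ 2 ≤ 1)
    (u : Fin N × Bool × W → ℂ) (hu : ∑ s, ‖u s‖ ^ 2 ≤ 1) :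
    ∑ U ∈ Finset.univ.filter (fun U : Finset (Fin N) => U.card = T₂),
        ∑ k ∈ U, ∑ s, ‖blockDiff k (gam c T₂ (fun _ : Fin N → Bool => u) U) s‖ ^ 2 ≤ 1 := by
  have e : ∀ U ∈ Finset.univ.filter (fun U : Finset (Fin N) => U.card = T₂), ∀ k ∈ U,
      ∑ s, ‖blockDiff k (gam c T₂ (fun _ : Fin N → Bool => u) U) s‖ ^ 2 =
        ‖c U‖ ^ 2 * ∑ s, ‖blockDiff k u s‖ ^ 2 := by
    intro U hU k _
    rw [Finset.mem_filter] at hU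
    rw [gam_top c _ hU.2, vfc_const_empty, blockDiff_smul, sum_norm_sq_smul]
  rw [Finset.sum_congr rfl fun U hU => Finset.sum_congr rfl fun k hk => e U hU k hk, sum_card_sum_mem]
  calc ∑ k : Fin N, ∑ U ∈ Finset.univ.filter (fun U : Finset (Fin N) => U.card = T₂ ∧ k ∈ U),
          ‖c U‖ ^ 2 * ∑ s, ‖blockDiff k u s‖ ^ 2
      = ∑ k : Fin N, (∑ U ∈ Finset.univ.filter (fun U : Finset (Fin N) => U.card = T₂ ∧ k ∈ U), ‖c U‖ ^ 2) *
          ∑ s, ‖blockDiff k u s‖ ^ 2 := by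
        refine Finset.sum_congr rfl fun k _ => ?_
        rw [Finset.sum_mul]
    _ ≤ ∑ k : Fin N, 1 * ∑ s, ‖blockDiff k u s‖ ^ 2 :=
        Finset.sum_le_sum fun k _ => mul_le_mul_of_nonneg_right (hc k)
          (Finset.sum_nonneg fun s _ => by positivity)
    _ ≤ 1 := by
        simp_rw [one_mul]
        exact (sum_norm_sq_blockDiff_le u).trans hu

end Summit.QuantumAdvantage.QuantumAdvantage.Theorems.SosSandwich.QueryTopLevel

end
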